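import Summits.HubbardSuperconductivity.HubbardSuperconductivity.Theorems.AnisotropyChordTransferFibre3KernelHarmonicity
import Summits.HubbardSuperconductivity.HubbardSuperconductivity.Theorems.AnisotropyChordTransferFibre3Lam2Bounds
import Summits.HubbardSuperconductivity.HubbardSuperconductivity.Theorems.AnisotropyChordTransferFibre3LamPart
import Summits.HubbardSuperconductivity.HubbardSuperconductivity.Theorems.AnisotropyChordTransferFibre3QuasiNull

/-!
# Route `AnisotropyChord` / H0 rotor rung: the LOGARITHMIC a-priori bound on the ground two-magnon eigenvalue, I — `λ₂ ≤ 1/(V·G̃₀(0))`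

Regime facts of the GM₃ ∀L certificate (memo ROTOR-THEORY-21 §296/§302, LEVEL2-SPEC §2: the Level-2 cells live on
`ν = λ₂/θ² ∈ (0, ν_max]`, and `m = ε₁cos²θ/2 − T⁺ ≥ 0` needs `T⁺ = 3λ₂(1+δ₃)` small).  The tree's `lam2_le`/`etaEff_le`
(`…Fibre3Lam2Bounds`, test function `1 − δ₀`) give only `η_eff ≤ (1−Δ)V/(V−1)`; the true law is `η_eff ≈ π/(2 ln L)`.
This file proves the log-accurate version by testing the minimality in `IsGroundTwoMagnon` on the `λ = 0` TORUS KERNEL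
`g = a₀ := aKer L 0` (which vanishes at the origin):
* `sum_Gres` (`Σ_r G̃_λ(r) = 0`, zero mode removed), `Gres_zero_eq` (`G̃_λ(0) = (1/V)Σ_k g(k)`), `gres_zero_nonneg`, `Gres_zero_zero_pos`;
* `qf_aKer_zero`: `Q_Δ(a₀) = G̃₀(0) − 4Δ·a₀(eₓ)²` (harmonicity `kernelHarmonicity_holds` at `λ = 0`), `sum_aKer_zero_sq`:
  `Σ a₀² = V·G̃₀(0)² + Σ_r G̃₀(r)²`, `aKer_zero_axis`: `a₀(eₓ) = (1 − 1/V)/4`;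
* ★ `lam2_mul_le_of_ground`: `λ₂·(V·G̃₀(0)² + Σ_r G̃₀(r)²) ≤ G̃₀(0) − Δ(1 − 1/V)²/4`; ★ `lam2_le_inv_Gres` (`0 ≤ Δ`):
  `λ₂ ≤ 1/(V·G̃₀(0))`; ★ `etaEff_le_inv_Gres`: `η_eff ≤ 1/(4 G̃₀(0))`.
The explicit lower bound `G̃₀(0) ≥ H_{(L−1)/2}/π²` and the corollary `η_eff ≤ π²/(4H_N)` are in `…Fibre3GresZeroLower`.
Prover seat `hubbard-h0-rotor-p1` g24; helper for stmt-HubbardSuperconductivity-19089 (`--supports`).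
-/

set_option linter.dupNamespace false
set_option autoImplicit false

noncomputable section

open scoped BigOperators
open Complex

namespace Summit.HubbardSuperconductivity.HubbardSuperconductivity.Theorems.AnisotropyChord.Transfer.Fibre3

variable (L : ℕ) [NeZero L]

/-! ## The zero-mode-removed kernel: elementary facts -/

/-- `G̃_λ(0) = (1/V) Σ_k g(k)`. [folklore] -/
theorem Gres_zero_eq (lam2 : ℝ) : Gres L lam2 0 = (∑ k : Tor L, gres L lam2 k) / (L : ℝ) ^ 2 := by
  unfold Gres
  congr 1
  refine Finset.sum_congr rfl fun k _ => ?_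
  rw [phase_zero, Complex.one_re, mul_one]

/-- `Σ_r Re φ_k(r) = V·δ_{k,0}`. [folklore] -/
theorem sum_re_phase_right (k : Tor L) : ∑ r : Tor L, (phase L k r).re = if k = 0 then (L : ℝ) ^ 2 else 0 := by
  rw [← Complex.re_sum, sum_phase_right]
  split_ifs
  · rw [show ((L : ℂ)) ^ 2 = (((L : ℝ) ^ 2 : ℝ) : ℂ) by push_cast; ring, Complex.ofReal_re]
  · simp

/-- the zero mode is removed: `Σ_r G̃_λ(r) = 0`. [folklore] -/
theorem sum_Gres (lam2 : ℝ) : ∑ r : Tor L, Gres L lam2 r = 0 := by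
  unfold Gres
  rw [← Finset.sum_div, Finset.sum_comm]
  have h : ∀ k : Tor L, ∑ r : Tor L, gres L lam2 k * (phase L k r).re = 0 := by
    intro k
    rw [← Finset.mul_sum, sum_re_phase_right]
    by_cases hk : k = 0
    · rw [hk]; unfold gres; simp
    · rw [if_neg hk, mul_zero]
  rw [Finset.sum_congr rfl fun k _ => h k]
  simp

/-- `g₀(k) = 1/(2ε(k)) ≥ 0` (and `g₀(0) = 0`), `L ≥ 2`. [folklore] -/
theorem gres_zero_nonneg (hL : 2 ≤ L) (k : Tor L) : 0 ≤ gres L 0 k := by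
  unfold gres
  by_cases hk : k = 0
  · rw [if_pos hk]
  · rw [if_neg hk, sub_zero]
    have h1 := eps1_le_epsT L hL hk
    have h2 := RateLemma.eps1_pos_of_two_le L hL
    have : 0 < epsT L k := lt_of_lt_of_le h2 h1
    positivity

/-- `g₀(eₓ) = 1/(2ε₁) > 0`, `L ≥ 2`. [folklore] -/
theorem gres_zero_ex_pos (hL : 2 ≤ L) : 0 < gres L 0 (ex L) := by
  unfold gres
  have hx : ex L ≠ 0 := (exy_ne L hL).1
  rw [if_neg hx, sub_zero]
  have h1 := eps1_le_epsT L hL hx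
  have h2 := RateLemma.eps1_pos_of_two_le L hL
  have : 0 < epsT L (ex L) := lt_of_lt_of_le h2 h1
  positivity

/-- `G̃₀(0) > 0`, `L ≥ 2`. [folklore] -/
theorem Gres_zero_zero_pos (hL : 2 ≤ L) : 0 < Gres L 0 0 := by
  rw [Gres_zero_eq]
  have hV : (0 : ℝ) < (L : ℝ) ^ 2 := by
    have : (0 : ℝ) < L := by exact_mod_cast Nat.pos_of_ne_zero (NeZero.ne L)
    positivity
  apply div_pos _ hV
  calc (0 : ℝ) < gres L 0 (ex L) := gres_zero_ex_pos L hL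
    _ = ∑ k ∈ ({ex L} : Finset (Tor L)), gres L 0 k := by rw [Finset.sum_singleton]
    _ ≤ ∑ k : Tor L, gres L 0 k :=
        Finset.sum_le_sum_of_subset_of_nonneg (Finset.subset_univ _) fun k _ _ => gres_zero_nonneg L hL k

/-! ## The trial function `a₀ = aKer L 0` -/

/-- `a₀(eₓ) = (1 − 1/V)/4` (`KernelAxisValue` at `λ = 0`), `L ≥ 2`. [folklore] -/
theorem aKer_zero_axis (hL : 2 ≤ L) : aKer L 0 (ex L) = (1 - 1 / (L : ℝ) ^ 2) / 4 := by
  have h2 : (0 : ℝ) < 2 * eps1 L := by linarith [RateLemma.eps1_pos_of_two_le L hL]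
  have h := kernelAxisValue_holds L 0 le_rfl h2
  rw [show ex L = (((1 : ZMod L)), (0 : ZMod L)) from rfl, h]
  ring

/-- the neighbour sum of `a₀`: `Σ_e a₀(r+e) = 4a₀(r) + δ_{r,0} − 1/V`, `L ≥ 2`. [folklore] -/
theorem nbSum_aKer_zero (hL : 2 ≤ L) (r : Tor L) :
    nbSum L (aKer L 0) r = 4 * aKer L 0 r + (if r = 0 then (1 : ℝ) else 0) - 1 / (L : ℝ) ^ 2 := by
  have h2 : (0 : ℝ) < 2 * eps1 L := by linarith [RateLemma.eps1_pos_of_two_le L hL]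
  have h := kernelHarmonicity_holds L 0 le_rfl h2 r
  rw [nnList_map_sum] at h
  unfold nbSum
  linarith

/-- `a₀` takes the value `a₀(eₓ)` on all four nearest neighbours. [folklore] -/
theorem aKer_zero_of_isNN {r : Tor L} (h : IsNN L r = true) : aKer L 0 r = aKer L 0 (ex L) := by
  have hy : aKer L 0 (ey L) = aKer L 0 (ex L) := by
    have : ey L = ((ex L).2, (ex L).1) := rfl
    rw [this]; unfold aKer; rw [Gres_swap]
  rcases eq_of_isNN L h with e | e | e | e <;> rw [e]
  · unfold aKer; rw [Gres_neg]
  · exact hy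
  · unfold aKer; rw [Gres_neg]; exact hy

/-- ★ the quadratic form on the trial function: `Q_Δ(a₀) = G̃₀(0) − 4Δ·a₀(eₓ)²`, `L ≥ 3`. [folklore] -/
theorem qf_aKer_zero (hL : 3 ≤ L) (Δ : ℝ) :
    twoMagnonQF L Δ (aKer L 0) = Gres L 0 0 - 4 * Δ * aKer L 0 (ex L) ^ 2 := by
  have hL2 : 2 ≤ L := by omega
  rw [twoMagnonQF_eq]
  have hpt : ∀ r : Tor L, (4 - Δ * nnInd L r) * aKer L 0 r ^ 2 - aKer L 0 r * nbSum L (aKer L 0) r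
      = aKer L 0 r / (L : ℝ) ^ 2 - Δ * (nnInd L r * aKer L 0 (ex L) ^ 2) := by
    intro r
    rw [nbSum_aKer_zero L hL2 r]
    have hnn : nnInd L r * aKer L 0 r ^ 2 = nnInd L r * aKer L 0 (ex L) ^ 2 := by
      unfold nnInd
      by_cases h : IsNN L r = true
      · rw [if_pos h, aKer_zero_of_isNN L h]
      · rw [if_neg h]; ring
    by_cases hr : r = 0
    · rw [if_pos hr, hr, OneHoleTorus.aKer_zero]
      unfold nnInd; rw [isNN_zero L hL2]; simp
    · rw [if_neg hr]
      calc (4 - Δ * nnInd L r) * aKer L 0 r ^ 2 - aKer L 0 r * (4 * aKer L 0 r + 0 - 1 / (L : ℝ) ^ 2)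
          = aKer L 0 r / (L : ℝ) ^ 2 - Δ * (nnInd L r * aKer L 0 r ^ 2) := by ring
        _ = _ := by rw [hnn]
  rw [Finset.sum_congr rfl fun r _ => hpt r, Finset.sum_sub_distrib, ← Finset.sum_div, ← Finset.mul_sum,
    ← Finset.sum_mul, sum_nnInd L hL]
  have hsum : ∑ r : Tor L, aKer L 0 r = (L : ℝ) ^ 2 * Gres L 0 0 := by
    unfold aKer
    rw [Finset.sum_sub_distrib, sum_Gres, Finset.sum_const, Finset.card_univ]
    have hcard : (Fintype.card (Tor L) : ℝ) = (L : ℝ) ^ 2 := by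
      rw [Fintype.card_prod, ZMod.card]; push_cast; ring
    rw [nsmul_eq_mul, hcard]; ring
  rw [hsum]
  have hV : (L : ℝ) ^ 2 ≠ 0 := by
    have : (0 : ℝ) < L := by exact_mod_cast Nat.pos_of_ne_zero (NeZero.ne L)
    positivity
  field_simp

/-- `Σ_r a₀(r)² = V·G̃₀(0)² + Σ_r G̃₀(r)²`. [folklore] -/
theorem sum_aKer_zero_sq :
    ∑ r : Tor L, aKer L 0 r ^ 2 = (L : ℝ) ^ 2 * Gres L 0 0 ^ 2 + ∑ r : Tor L, Gres L 0 r ^ 2 := by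
  have hpt : ∀ r : Tor L, aKer L 0 r ^ 2 = Gres L 0 0 ^ 2 - 2 * Gres L 0 0 * Gres L 0 r + Gres L 0 r ^ 2 := by
    intro r; unfold aKer; ring
  rw [Finset.sum_congr rfl fun r _ => hpt r, Finset.sum_add_distrib, Finset.sum_sub_distrib, ← Finset.mul_sum,
    sum_Gres, Finset.sum_const, Finset.card_univ]
  have hcard : (Fintype.card (Tor L) : ℝ) = (L : ℝ) ^ 2 := by
    rw [Fintype.card_prod, ZMod.card]; push_cast; ring
  rw [nsmul_eq_mul, hcard]; ring

/-! ## The variational bound -/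

/-- ★ **minimality on the torus kernel:** `λ₂·(V·G̃₀(0)² + Σ_r G̃₀(r)²) ≤ G̃₀(0) − Δ(1 − 1/V)²/4` for the ground profile, `L ≥ 3`. [folklore] -/
theorem lam2_mul_le_of_ground (hL : 3 ≤ L) {Δ lam2 : ℝ} {f : Tor L → ℝ} (hf : IsGroundTwoMagnon L Δ lam2 f) :
    lam2 * ((L : ℝ) ^ 2 * Gres L 0 0 ^ 2 + ∑ r : Tor L, Gres L 0 r ^ 2)
      ≤ Gres L 0 0 - Δ * (1 - 1 / (L : ℝ) ^ 2) ^ 2 / 4 := by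
  obtain ⟨_, _, hmin⟩ := hf
  have h := hmin (aKer L 0) (OneHoleTorus.aKer_zero L 0)
  rw [sum_aKer_zero_sq, qf_aKer_zero L hL, aKer_zero_axis L (by omega)] at h
  calc lam2 * ((L : ℝ) ^ 2 * Gres L 0 0 ^ 2 + ∑ r : Tor L, Gres L 0 r ^ 2)
      ≤ Gres L 0 0 - 4 * Δ * ((1 - 1 / (L : ℝ) ^ 2) / 4) ^ 2 := h
    _ = _ := by ring

/-- ★ **`λ₂ ≤ 1/(V·G̃₀(0))`** for the ground profile (`L ≥ 3`, `0 ≤ Δ`). [folklore] -/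
theorem lam2_le_inv_Gres (hL : 3 ≤ L) {Δ lam2 : ℝ} (hΔ : 0 ≤ Δ) {f : Tor L → ℝ} (hf : IsGroundTwoMagnon L Δ lam2 f) :
    lam2 ≤ 1 / ((L : ℝ) ^ 2 * Gres L 0 0) := by
  have hG := Gres_zero_zero_pos L (by omega)
  have hV : (0 : ℝ) < (L : ℝ) ^ 2 := by
    have : (0 : ℝ) < L := by exact_mod_cast Nat.pos_of_ne_zero (NeZero.ne L)
    positivity
  have hpos : 0 < (L : ℝ) ^ 2 * Gres L 0 0 := mul_pos hV hG
  by_cases hl : lam2 ≤ 0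
  · exact hl.trans (by positivity)
  · have hl' : 0 < lam2 := lt_of_not_ge hl
    have h := lam2_mul_le_of_ground L hL hf
    have hS : 0 ≤ ∑ r : Tor L, Gres L 0 r ^ 2 := Finset.sum_nonneg fun r _ => sq_nonneg _
    have hD : 0 ≤ Δ * (1 - 1 / (L : ℝ) ^ 2) ^ 2 / 4 := by positivity
    have h1 : lam2 * ((L : ℝ) ^ 2 * Gres L 0 0 ^ 2) ≤ Gres L 0 0 := by nlinarith
    rw [le_div_iff₀ hpos]
    nlinarith

/-- ★ **`η_eff ≤ 1/(4 G̃₀(0))`** for the ground profile (`L ≥ 3`, `0 ≤ Δ`). [folklore] -/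
theorem etaEff_le_inv_Gres (hL : 3 ≤ L) {Δ lam2 : ℝ} (hΔ : 0 ≤ Δ) {f : Tor L → ℝ} (hf : IsGroundTwoMagnon L Δ lam2 f) :
    etaEff L lam2 ≤ 1 / (4 * Gres L 0 0) := by
  have hG := Gres_zero_zero_pos L (by omega)
  have hV : (0 : ℝ) < (L : ℝ) ^ 2 := by
    have : (0 : ℝ) < L := by exact_mod_cast Nat.pos_of_ne_zero (NeZero.ne L)
    positivity
  have h := lam2_le_inv_Gres L hL hΔ hf
  unfold etaEff
  rw [le_div_iff₀ (mul_pos hV hG)] at h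
  rw [le_div_iff₀ (by positivity)]
  have e : (L : ℝ) ^ 2 * lam2 / 4 * (4 * Gres L 0 0) = lam2 * ((L : ℝ) ^ 2 * Gres L 0 0) := by ring
  rw [e]; exact h

end Summit.HubbardSuperconductivity.HubbardSuperconductivity.Theorems.AnisotropyChord.Transfer.Fibre3

end
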